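import Literature.MathematicalPhysics.QuantumFieldTheory.Balaban1983to89.B13
import Literature.MathematicalPhysics.QuantumFieldTheory.Balaban1983to89.T4OutputRate

/-!
# B13HistDatum — row O1-c (HISTORY ∕ TABLES) of the NE5 crux O1, part 1 of 2: the normed space `Hist` of inserted earlier
# actions (potential tables with the (1.36)∕(1.43)-weighted sup norm) and the history margin (cell `pub-balaban`, T⁴ fan-out,
# `HOME/t4/b2b-balaban-t4-ne5-p1/O1-CLAIM-TABLE-NE5-P1.md` row O1-c; design `B13StepDesign.md` v0.2 RULES R3, R6)

Unit `b2b-balaban-t4-ne5-formalise-leaf-06` (NE5 formalisation swarm, leaf prover 06).  Summits-side NEW WORK under the LEAN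
PLACEMENT RULE (cell modelling + bookkeeping; NOT a Literature module; the manuscripts under audit are cited for KIND ∕ locus
only, nothing of them is asserted).  HONEST FRAMING: rung (B)+1 of the FINITE-VOLUME T⁴ continuum programme — NOT infinite
volume, NOT a mass gap, NOT the Clay problem, NOT a proof of NE5 (NE5 is NOT PRINTED in [Balaban1987RG1]–[Balaban1989LargeFieldII]:
they print ε-UNIFORM bounds, never two-spacing RATES; cell GAPS G-t4-U3-1).  HONEST DEPENDENCY (cell line, verbatim): continuum YM
on T⁴ ⇐ BetaPertH ∧ nine spine estimates (0/9 proved); BetaPertH ⇐ (D1) ∧ (D4) ∧ CAP+tail; G-an2-4 gates asym, D1 and NE2/3/4.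

WHAT THIS FILE TYPES (types + definitions + by-construction bookkeeping; NO estimate).  The END faces of binder row NE5
(`T4InputCauchyRateData.StepModel.ne5_at_of_stepModel_lip_nat` and its Summits-side sockets) are stated over an ABSTRACT complex
normed space `Hist` of "inserted histories" with a margin `rHist k`.  For the instance of [Balaban1988RG2Cluster] (= [II]) the
design fixes (RULE R3): `Hist` = the POTENTIALS `𝐕_k(Y, ·)` of Lemma 2 (1.41)–(1.43) p. 11 as functions of the unit-lattice
fluctuation field, split as in (1.42) into the kernel `Q(Y, B, b, b′)` of the quadratic form and the remainder `V″_k(Y, B)`, normed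
by the WEIGHTED SUP NORM whose weights are the printed one-run level formats — (1.36) p. 9 for `V″` and (1.43) p. 11 for `Q`, i.e.
the right-hand sides of the tree's quoted shapes `B13.Bound136` ∕ `B13.Bound143` reused literally (`bound136_iff_level`,
`bound143_iff_level`); the margin `rHist` = the dilation slack of the budget ball (RULE R6, record `t4/T4-EST-NE5-P1.md` §27).
* §1 `HistFrame C` (DATA: entries, their domains, positive weights), `Hist F` := bounded complex tables on the entries (a Banach
  space — Mathlib's bounded continuous functions on the DISCRETE entry type `Entry F`), the PHYSICAL read-out `read h i = wt i · h i`
  as the bounded linear functional `readCLM i` with `‖readCLM i‖ ≤ wt i`, the constructor `ofBound`, and the dictionary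
  `norm_le_iff_read` ("‖h‖ ≤ μ ⟺ every entry obeys its level format with the factor μ").
* §2 `PotFrame C` (DATA: per domain `Y` the argument type `Arg Y` of the potentials — the configurations of the space (1.34) p. 9 at
  `Y` on which they are read; WHICH type, e.g. the rescaled small-field polydisc of fluctuation fields on the bonds of `Y` at the
  data's background, is the instancer's choice (design Q3, rows O1-a ∕ O1-d) —, the bonds `Bond Y`, the bond variables `Bv`, the
  cube count `vol Y = M⁻⁴|Y|`, the constants `B13.Consts` with the positivity of the five that enter the weights), the entry type
  `PotIdx` (`rem Y φ` ↦ `V″(Y, φ)`, `ker Y φ b b′` ↦ `Q(Y, φ, b, b′)`), the weights `level136` ∕ `level143`, the space `B13Hist P`,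
  the read-outs `Vpp`, `Qker` and the potential value `pot h Y φ = ½ Σ_{b,b′} Q(Y, φ, b, b′) Bv(b) Bv(b′) + V″(Y, φ)` ((1.42), the
  shape of `B13.StepData.quadForm`) as the bounded linear functional `potCLM Y φ` with `‖potCLM Y φ‖ ≤ potWt Y φ` — so the
  ingredient `Λ(a) : Hist →L[ℂ] ℂ` of the exp-linear structure `T4InputCauchyRateTermwise.TermHistExpLinear` and the bounded-linear
  history read-out of `ActivityTermReadouts.readLip_of_linear_clm` are AVAILABLE BY CONSTRUCTION on this space —, the dictionary
  `norm_le_iff` (‖h‖ ≤ μ ⟺ (1.36) ∧ (1.43) with the factor μ: the row-O1-f reading of the admissible base as a budget ball) and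
  the constructor `ofPotentials` with its read-back lemmas.
* §3 `histMargin lam μ` (the `k`-independent margin `λ − μ` in these units: class radius `λ`, actual budget fraction `μ`).
Part 2 (`B13HistInsertion`) types the insertion maps `insA ∕ insB` (RULE R3′).
WHAT IS NOT HERE: no estimate of [II]; no `StepModel` instance (rows O1-a∕b∕d∕e∕f); no choice of `Arg Y`; no claim that
Bałaban's potentials lie in any ball of `B13Hist P` — that is the quoted one-run leaf (Lemma 2 p. 11, locator only, trigger rule
c4), displayed by the consumers as a hypothesis.  0 sorry; axioms ⊆ {propext, Classical.choice, Quot.sound}.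
-/

noncomputable section

open scoped BigOperators
open Finset

namespace Summit.QuantumFields.BalabanUV.T4Continuum.B13HistDatum

open Literature.MathematicalPhysics.QuantumFieldTheory.Balaban1983to89
open Literature.MathematicalPhysics.QuantumFieldTheory.Balaban1983to89.T4OutputRate (Carriers)

/-! ## §1 Weighted bounded tables: the generic history space -/

section Frame

variable {C : Carriers}

/-- [folklore] DATA (no inequality inside): a HISTORY FRAME over the carriers — an index type of table ENTRIES, the localization
domain each entry belongs to, and the positive WEIGHT of the entry (the one-run level format that serves as the unit of the norm). -/
structure HistFrame (C : Carriers) where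
  /-- the entries of a history table -/
  Idx : Type
  /-- the localization domain an entry belongs to -/
  dom : Idx → C.Dom
  /-- the weight (level format, physical units) of an entry -/
  wt : Idx → ℝ
  wt_pos : ∀ i, 0 < wt i

/-- [folklore] The entry type of a frame, wrapped so that it carries the DISCRETE topology (tables are arbitrary bounded functions
of the entries; no continuity in the field argument is built into the norm). -/
structure Entry (F : HistFrame C) where
  /-- the underlying entry -/
  idx : F.Idx

/-- [folklore] The discrete topology on the entries. -/
instance (F : HistFrame C) : TopologicalSpace (Entry F) := ⊥

/-- [folklore] … which is discrete by definition. -/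
instance (F : HistFrame C) : DiscreteTopology (Entry F) := ⟨rfl⟩

/-- [folklore] THE HISTORY SPACE of a frame: bounded complex tables on the entries with the sup norm (a Banach space; the weights
are carried by the read-out, so that `‖h‖ ≤ μ` reads "every entry obeys its level format with the factor `μ`"). -/
abbrev Hist (F : HistFrame C) : Type := BoundedContinuousFunction (Entry F) ℂ

namespace HistFrame

variable (F : HistFrame C)

/-- [folklore] The PHYSICAL read-out of the entry `i` of a table: weight × stored value. -/
def read (h : Hist F) (i : F.Idx) : ℂ := (F.wt i : ℂ) * h ⟨i⟩

/-- [folklore] The read-out of an entry as a bounded ℂ-linear functional on the history space. -/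
def readCLM (i : F.Idx) : Hist F →L[ℂ] ℂ := (F.wt i : ℂ) • BoundedContinuousFunction.evalCLM ℂ (⟨i⟩ : Entry F)

/-- [folklore] The read-out functional evaluates to the read-out (additivity ∕ homogeneity of `read` follow by `map_add` etc.). -/
@[simp] theorem readCLM_apply (i : F.Idx) (h : Hist F) : F.readCLM i h = F.read h i := by
  simp [readCLM, read, smul_eq_mul]

/-- [folklore] An entry is at most its weight times the norm of the table. -/
theorem norm_read_le (h : Hist F) (i : F.Idx) : ‖F.read h i‖ ≤ F.wt i * ‖h‖ := by
  rw [read, norm_mul, Complex.norm_real, Real.norm_eq_abs, abs_of_pos (F.wt_pos i)]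
  exact mul_le_mul_of_nonneg_left (h.norm_coe_le_norm ⟨i⟩) (F.wt_pos i).le

/-- [folklore] The read-out functional of the entry `i` has operator norm at most the weight of `i`. -/
theorem norm_readCLM_le (i : F.Idx) : ‖F.readCLM i‖ ≤ F.wt i :=
  ContinuousLinearMap.opNorm_le_bound _ (F.wt_pos i).le fun h => by
    rw [readCLM_apply]; exact F.norm_read_le h i

/-- [folklore] THE DICTIONARY: for `μ ≥ 0`, a table has norm `≤ μ` iff every physical entry obeys its level format with the factor
`μ`. -/
theorem norm_le_iff_read (h : Hist F) {μ : ℝ} (hμ : 0 ≤ μ) : ‖h‖ ≤ μ ↔ ∀ i, ‖F.read h i‖ ≤ μ * F.wt i := by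
  have key : ∀ i, ‖F.read h i‖ = F.wt i * ‖h ⟨i⟩‖ := fun i => by
    rw [read, norm_mul, Complex.norm_real, Real.norm_eq_abs, abs_of_pos (F.wt_pos i)]
  rw [BoundedContinuousFunction.norm_le hμ]
  refine ⟨fun hle i => ?_, fun hle e => ?_⟩
  · rw [key, mul_comm]
    exact mul_le_mul_of_nonneg_right (hle ⟨i⟩) (F.wt_pos i).le
  · obtain ⟨i⟩ := e
    refine le_of_mul_le_mul_left ?_ (F.wt_pos i)
    calc F.wt i * ‖h ⟨i⟩‖ = ‖F.read h i‖ := (key i).symm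
      _ ≤ μ * F.wt i := hle i
      _ = F.wt i * μ := mul_comm _ _

/-- [folklore] CONSTRUCTOR: a family of physical entries obeying the level formats with the factor `μ` IS a table of norm `≤ μ`
(stored values = entries ÷ weights). -/
def ofBound (V : F.Idx → ℂ) (μ : ℝ) (hV : ∀ i, ‖V i‖ ≤ μ * F.wt i) : Hist F :=
  BoundedContinuousFunction.ofNormedAddCommGroupDiscrete (fun e : Entry F => V e.idx / (F.wt e.idx : ℂ)) μ fun e => by
    have hw := F.wt_pos e.idx
    rw [norm_div, Complex.norm_real, Real.norm_eq_abs, abs_of_pos hw, div_le_iff₀ hw]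
    exact hV e.idx

/-- [folklore] The constructor reproduces the prescribed physical entries. -/
@[simp] theorem read_ofBound (V : F.Idx → ℂ) (μ : ℝ) (hV : ∀ i, ‖V i‖ ≤ μ * F.wt i) (i : F.Idx) :
    F.read (F.ofBound V μ hV) i = V i := by
  have hw : (F.wt i : ℂ) ≠ 0 := Complex.ofReal_ne_zero.2 (F.wt_pos i).ne'
  simp only [read, ofBound, BoundedContinuousFunction.coe_ofNormedAddCommGroupDiscrete]
  rw [mul_div_cancel₀ _ hw]

/-- [folklore] … and has norm at most the factor. -/
theorem norm_ofBound_le (V : F.Idx → ℂ) {μ : ℝ} (hμ : 0 ≤ μ) (hV : ∀ i, ‖V i‖ ≤ μ * F.wt i) :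
    ‖F.ofBound V μ hV‖ ≤ μ :=
  (F.norm_le_iff_read _ hμ).2 fun i => by rw [read_ofBound]; exact hV i

end HistFrame

end Frame

/-! ## §2 The potential frame of [II] Lemma 2: entries `V″(Y, φ)` and `Q(Y, φ, b, b′)`, weights (1.36) ∕ (1.43) -/

section Potentials

variable {C : Carriers}

/-- [folklore] The printed LEVEL FORMAT of (1.36) p. 9 of [II] at tree length `d` — `E₀ε₁C₁M^q exp C₂κ₁ exp(−(1 − 2δ)κ d)` — i.e.
literally the right-hand side of the tree's quoted shape `B13.Bound136` (a unit of measurement here; nothing asserted). -/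
def level136 (c : B13.Consts) (d : ℝ) : ℝ :=
  c.E₀ * c.ε₁ * c.C₁ * c.M ^ c.q * Real.exp (c.C₂ * c.κ₁) * Real.exp (-((1 - 2 * c.δ) * c.κ * d))

/-- [folklore] The printed LEVEL FORMAT of (1.43) p. 11 of [II] at tree length `d` and cube count `v = M⁻⁴|Y|` —
`C₃ε₁M⁴ exp C₂κ₁ exp(−⅛(κ₁ − 1)d − ½(κ₁ − 1)v)` — literally the right-hand side of `B13.Bound143` (a unit; nothing asserted). -/
def level143 (c : B13.Consts) (d : ℝ) (v : ℕ) : ℝ :=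
  c.C₃ * c.ε₁ * c.M ^ 4 * Real.exp (c.C₂ * c.κ₁) * Real.exp (-((c.κ₁ - 1) / 8 * d + (c.κ₁ - 1) / 2 * (v : ℝ)))

/-- [folklore] Positivity of the five constants entering the level formats (a condition on the instancer's constants). -/
def PosUnits (c : B13.Consts) : Prop := 0 < c.E₀ ∧ 0 < c.ε₁ ∧ 0 < c.C₁ ∧ 0 < c.C₃ ∧ 0 < c.M

/-- [folklore] The (1.36) format is positive under `PosUnits`. -/
theorem level136_pos {c : B13.Consts} (hc : PosUnits c) (d : ℝ) : 0 < level136 c d := by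
  obtain ⟨hE, hε, hC₁, -, hM⟩ := hc
  unfold level136
  positivity

/-- [folklore] The (1.43) format is positive under `PosUnits`. -/
theorem level143_pos {c : B13.Consts} (hc : PosUnits c) (d : ℝ) (v : ℕ) : 0 < level143 c d v := by
  obtain ⟨-, hε, -, hC₃, hM⟩ := hc
  unfold level143
  positivity

/-- [folklore] BY NAME: the tree's quoted shape `B13.Bound136` IS the bound by the weight `level136` (definitional unfolding). -/
theorem bound136_iff_level (S : B13.StepData) (c : B13.Consts) (F : S.Dk.Dom → S.Φ → ℂ) :
    B13.Bound136 S c F ↔ ∀ Y φ, φ ∈ S.sp1 Y → ‖F Y φ‖ ≤ level136 c (S.Dk.dj Y) := Iff.rfl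

/-- [folklore] BY NAME: the tree's quoted shape `B13.Bound143` IS the bound by the weight `level143` (definitional unfolding). -/
theorem bound143_iff_level (S : B13.StepData) (c : B13.Consts) :
    B13.Bound143 S c ↔ ∀ Y φ (b b' : S.Bond), φ ∈ S.sp1 Y → ‖S.Q Y φ b b'‖ ≤ level143 c (S.Dk.dj Y) (S.volk Y) :=
  Iff.rfl

/-- [folklore] DATA (no inequality inside): the POTENTIAL FRAME over the carriers.  For every localization domain `Y`: the type
`Arg Y` of arguments on which the potentials at `Y` are read (the configurations of the space (1.34) p. 9 at `Y` — which type,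
e.g. the rescaled small-field polydisc of fluctuation fields on the bonds of `Y` at the data's background, is the instancer's
choice, design Q3), the finite type `Bond Y` of bonds of `Y`, the bond variables `Bv Y φ b = B(b)` at the argument `φ`, the cube
count `vol Y = M⁻⁴|Y|` of (1.43), and the constants of [II] with the positivity of those entering the weights. -/
structure PotFrame (C : Carriers) where
  /-- arguments of the potentials at `Y` -/
  Arg : C.Dom → Type
  /-- bonds of `Y` -/
  Bond : C.Dom → Type
  /-- finitely many bonds per domain -/
  finBond : ∀ Y, Fintype (Bond Y)
  /-- the bond variable `B(b)` at the argument `φ` -/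
  Bv : (Y : C.Dom) → Arg Y → Bond Y → ℂ
  /-- cube count `M⁻⁴|Y|` -/
  vol : C.Dom → ℕ
  /-- the constants of [II] §§1–2 (tree `B13.Consts`) -/
  consts : B13.Consts
  pos : PosUnits consts

/-- [folklore] The bonds of a domain form a finite type (the frame's datum `finBond`, registered for the `Σ_{b,b′}` below). -/
instance PotFrame.instFintypeBond (P : PotFrame C) (Y : C.Dom) : Fintype (P.Bond Y) := P.finBond Y

/-- [folklore] The ENTRIES of a potential table: the remainder `V″(Y, φ)` and the kernel entries `Q(Y, φ, b, b′)` of (1.42). -/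
inductive PotIdx (P : PotFrame C) : Type
  /-- the entry `V″(Y, φ)` -/
  | rem (Y : C.Dom) (φ : P.Arg Y) : PotIdx P
  /-- the entry `Q(Y, φ, b, b′)` -/
  | ker (Y : C.Dom) (φ : P.Arg Y) (b b' : P.Bond Y) : PotIdx P

namespace PotFrame

variable (P : PotFrame C)

/-- [folklore] The domain of an entry. -/
def idxDom : PotIdx P → C.Dom
  | .rem Y _ => Y
  | .ker Y _ _ _ => Y

/-- [folklore] The weight of an entry: (1.36) for `V″`, (1.43) for `Q`, at the tree length `C.d Y` (and cube count `vol Y`). -/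
def idxWt : PotIdx P → ℝ
  | .rem Y _ => level136 P.consts (C.d Y)
  | .ker Y _ _ _ => level143 P.consts (C.d Y) (P.vol Y)

/-- [folklore] The weights are positive. -/
theorem idxWt_pos : ∀ i, 0 < P.idxWt i
  | .rem Y _ => level136_pos P.pos (C.d Y)
  | .ker Y _ _ _ => level143_pos P.pos (C.d Y) (P.vol Y)

/-- [folklore] The history frame of the potential frame. -/
def frame : HistFrame C where
  Idx := PotIdx P
  dom := P.idxDom
  wt := P.idxWt
  wt_pos := P.idxWt_pos

end PotFrame

/-- [folklore] THE HISTORY SPACE OF ROW O1-c: potential tables `(Q(Y, ·, ·, ·), V″(Y, ·))_Y` with the (1.36)∕(1.43)-weighted sup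
norm. -/
abbrev B13Hist (P : PotFrame C) : Type := Hist P.frame

namespace PotFrame

variable (P : PotFrame C)

/-- [folklore] The remainder potential `V″(Y, φ)` of a table (physical units). -/
def Vpp (h : B13Hist P) (Y : C.Dom) (φ : P.Arg Y) : ℂ := P.frame.read h (.rem Y φ)

/-- [folklore] The kernel entry `Q(Y, φ, b, b′)` of a table (physical units). -/
def Qker (h : B13Hist P) (Y : C.Dom) (φ : P.Arg Y) (b b' : P.Bond Y) : ℂ := P.frame.read h (.ker Y φ b b')

/-- [folklore] The POTENTIAL VALUE `𝐕(Y, φ) = ½ Σ_{b,b′} Q(Y, φ, b, b′) B(b) B(b′) + V″(Y, φ)` of a table at `(Y, φ)` — the printed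
split (1.42) p. 11 read as a definition (same shape as the tree's `B13.StepData.quadForm`). -/
def pot (h : B13Hist P) (Y : C.Dom) (φ : P.Arg Y) : ℂ :=
  (1 / 2 : ℂ) * (∑ b, ∑ b', P.Qker h Y φ b b' * P.Bv Y φ b * P.Bv Y φ b') + P.Vpp h Y φ

/-- [folklore] `V″(Y, φ)` as a bounded linear functional of the table. -/
def VppCLM (Y : C.Dom) (φ : P.Arg Y) : B13Hist P →L[ℂ] ℂ := P.frame.readCLM (.rem Y φ)

/-- [folklore] `Q(Y, φ, b, b′)` as a bounded linear functional of the table. -/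
def QkerCLM (Y : C.Dom) (φ : P.Arg Y) (b b' : P.Bond Y) : B13Hist P →L[ℂ] ℂ := P.frame.readCLM (.ker Y φ b b')

/-- [folklore] The potential value at `(Y, φ)` as a bounded linear functional of the table (the history enters every (2.14)-term
through `exp[Σ_Y τ(Y)𝐕_k(Y, B)]`, p. 15 of [II]: these functionals are the `Λ(a)` of the exp-linear structure). -/
def potCLM (Y : C.Dom) (φ : P.Arg Y) : B13Hist P →L[ℂ] ℂ :=
  (1 / 2 : ℂ) • (∑ b, ∑ b', (P.Bv Y φ b * P.Bv Y φ b') • P.QkerCLM Y φ b b') + P.VppCLM Y φ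

/-- [folklore] `VppCLM` evaluates to `Vpp`. -/
@[simp] theorem VppCLM_apply (Y : C.Dom) (φ : P.Arg Y) (h : B13Hist P) : P.VppCLM Y φ h = P.Vpp h Y φ :=
  P.frame.readCLM_apply _ h

/-- [folklore] `QkerCLM` evaluates to `Qker`. -/
@[simp] theorem QkerCLM_apply (Y : C.Dom) (φ : P.Arg Y) (b b' : P.Bond Y) (h : B13Hist P) :
    P.QkerCLM Y φ b b' h = P.Qker h Y φ b b' :=
  P.frame.readCLM_apply _ h

/-- [folklore] `potCLM` evaluates to the potential value `pot` ((1.42) is linear in the table at a fixed argument). -/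
@[simp] theorem potCLM_apply (Y : C.Dom) (φ : P.Arg Y) (h : B13Hist P) : P.potCLM Y φ h = P.pot h Y φ := by
  simp only [potCLM, pot, _root_.add_apply, _root_.smul_apply, _root_.sum_apply, QkerCLM_apply, VppCLM_apply,
    smul_eq_mul]
  congr 1
  congr 1
  refine Finset.sum_congr rfl fun b _ => Finset.sum_congr rfl fun b' _ => ?_
  ring

/-- [folklore] `‖V″(Y, φ)‖ ≤ (1.36)-format × ‖h‖`. -/
theorem norm_Vpp_le (h : B13Hist P) (Y : C.Dom) (φ : P.Arg Y) :
    ‖P.Vpp h Y φ‖ ≤ level136 P.consts (C.d Y) * ‖h‖ :=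
  P.frame.norm_read_le h (.rem Y φ)

/-- [folklore] `‖Q(Y, φ, b, b′)‖ ≤ (1.43)-format × ‖h‖`. -/
theorem norm_Qker_le (h : B13Hist P) (Y : C.Dom) (φ : P.Arg Y) (b b' : P.Bond Y) :
    ‖P.Qker h Y φ b b'‖ ≤ level143 P.consts (C.d Y) (P.vol Y) * ‖h‖ :=
  P.frame.norm_read_le h (.ker Y φ b b')

/-- [folklore] The weight of the potential-value functional at `(Y, φ)`: `½ Σ_{b,b′} ‖B(b)‖‖B(b′)‖·(1.43)-format + (1.36)-format`. -/
def potWt (Y : C.Dom) (φ : P.Arg Y) : ℝ :=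
  1 / 2 * (∑ b, ∑ b', ‖P.Bv Y φ b‖ * ‖P.Bv Y φ b'‖ * level143 P.consts (C.d Y) (P.vol Y)) + level136 P.consts (C.d Y)

/-- [folklore] The potential-value functional is bounded by its weight: `‖potCLM Y φ‖ ≤ potWt Y φ`. -/
theorem norm_potCLM_le (Y : C.Dom) (φ : P.Arg Y) : ‖P.potCLM Y φ‖ ≤ P.potWt Y φ := by
  have h143 := (level143_pos P.pos (C.d Y) (P.vol Y)).le
  have hQ : ∀ b b', ‖(P.Bv Y φ b * P.Bv Y φ b') • P.QkerCLM Y φ b b'‖ ≤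
      ‖P.Bv Y φ b‖ * ‖P.Bv Y φ b'‖ * level143 P.consts (C.d Y) (P.vol Y) := fun b b' => by
    rw [norm_smul, norm_mul]
    exact mul_le_mul_of_nonneg_left (P.frame.norm_readCLM_le (.ker Y φ b b')) (by positivity)
  have hsum : ‖∑ b, ∑ b', (P.Bv Y φ b * P.Bv Y φ b') • P.QkerCLM Y φ b b'‖ ≤
      ∑ b, ∑ b', ‖P.Bv Y φ b‖ * ‖P.Bv Y φ b'‖ * level143 P.consts (C.d Y) (P.vol Y) :=
    (norm_sum_le _ _).trans (Finset.sum_le_sum fun b _ => (norm_sum_le _ _).trans (Finset.sum_le_sum fun b' _ => hQ b b'))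
  calc ‖P.potCLM Y φ‖ ≤ ‖(1 / 2 : ℂ) • ∑ b, ∑ b', (P.Bv Y φ b * P.Bv Y φ b') • P.QkerCLM Y φ b b'‖ + ‖P.VppCLM Y φ‖ :=
        norm_add_le _ _
    _ ≤ 1 / 2 * (∑ b, ∑ b', ‖P.Bv Y φ b‖ * ‖P.Bv Y φ b'‖ * level143 P.consts (C.d Y) (P.vol Y)) +
          level136 P.consts (C.d Y) := by
        refine add_le_add ?_ (P.frame.norm_readCLM_le (.rem Y φ))
        rw [norm_smul]
        have : ‖(1 / 2 : ℂ)‖ = 1 / 2 := by norm_num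
        rw [this]
        exact mul_le_mul_of_nonneg_left hsum (by norm_num)

/-- [folklore] THE DICTIONARY FOR ROW O1-f: for `μ ≥ 0`, `‖h‖ ≤ μ` iff the remainder obeys (1.36) and the kernel obeys (1.43), both
with the factor `μ` (so the actual potentials of Lemma 2 would be a table of norm `≤ 1`, and the class of the END faces is a ball of
radius `λ > 1` — trigger rule c4: the membership itself is a QUOTED one-run leaf, not proved here). -/
theorem norm_le_iff (h : B13Hist P) {μ : ℝ} (hμ : 0 ≤ μ) :
    ‖h‖ ≤ μ ↔ (∀ Y φ, ‖P.Vpp h Y φ‖ ≤ μ * level136 P.consts (C.d Y)) ∧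
      ∀ Y φ b b', ‖P.Qker h Y φ b b'‖ ≤ μ * level143 P.consts (C.d Y) (P.vol Y) := by
  rw [P.frame.norm_le_iff_read h hμ]
  constructor
  · exact fun H => ⟨fun Y φ => H (.rem Y φ), fun Y φ b b' => H (.ker Y φ b b')⟩
  · rintro ⟨Hr, Hk⟩ (⟨Y, φ⟩ | ⟨Y, φ, b, b'⟩)
    · exact Hr Y φ
    · exact Hk Y φ b b'

/-- [folklore] CONSTRUCTOR: potentials `V″`, `Q` obeying (1.36) ∕ (1.43) with the factor `μ` give a table (of norm `≤ μ`). -/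
def ofPotentials (V : (Y : C.Dom) → P.Arg Y → ℂ) (Q : (Y : C.Dom) → P.Arg Y → P.Bond Y → P.Bond Y → ℂ) (μ : ℝ)
    (hV : ∀ Y φ, ‖V Y φ‖ ≤ μ * level136 P.consts (C.d Y))
    (hQ : ∀ Y φ b b', ‖Q Y φ b b'‖ ≤ μ * level143 P.consts (C.d Y) (P.vol Y)) : B13Hist P :=
  P.frame.ofBound (fun i => match i with
    | .rem Y φ => V Y φ
    | .ker Y φ b b' => Q Y φ b b') μ fun i => by
      cases i with
      | rem Y φ => exact hV Y φ
      | ker Y φ b b' => exact hQ Y φ b b'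

/-- [folklore] The constructor reproduces the prescribed remainder `V″`. -/
@[simp] theorem Vpp_ofPotentials (V : (Y : C.Dom) → P.Arg Y → ℂ) (Q : (Y : C.Dom) → P.Arg Y → P.Bond Y → P.Bond Y → ℂ)
    (μ : ℝ) (hV : ∀ Y φ, ‖V Y φ‖ ≤ μ * level136 P.consts (C.d Y))
    (hQ : ∀ Y φ b b', ‖Q Y φ b b'‖ ≤ μ * level143 P.consts (C.d Y) (P.vol Y)) (Y : C.Dom) (φ : P.Arg Y) :
    P.Vpp (P.ofPotentials V Q μ hV hQ) Y φ = V Y φ :=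
  P.frame.read_ofBound _ _ _ _

/-- [folklore] The constructor reproduces the prescribed kernel `Q`. -/
@[simp] theorem Qker_ofPotentials (V : (Y : C.Dom) → P.Arg Y → ℂ) (Q : (Y : C.Dom) → P.Arg Y → P.Bond Y → P.Bond Y → ℂ)
    (μ : ℝ) (hV : ∀ Y φ, ‖V Y φ‖ ≤ μ * level136 P.consts (C.d Y))
    (hQ : ∀ Y φ b b', ‖Q Y φ b b'‖ ≤ μ * level143 P.consts (C.d Y) (P.vol Y)) (Y : C.Dom) (φ : P.Arg Y)
    (b b' : P.Bond Y) : P.Qker (P.ofPotentials V Q μ hV hQ) Y φ b b' = Q Y φ b b' :=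
  P.frame.read_ofBound _ _ _ _

/-- [folklore] … and yields a table of norm at most the factor `μ`. -/
theorem norm_ofPotentials_le (V : (Y : C.Dom) → P.Arg Y → ℂ) (Q : (Y : C.Dom) → P.Arg Y → P.Bond Y → P.Bond Y → ℂ)
    {μ : ℝ} (hμ : 0 ≤ μ) (hV : ∀ Y φ, ‖V Y φ‖ ≤ μ * level136 P.consts (C.d Y))
    (hQ : ∀ Y φ b b', ‖Q Y φ b b'‖ ≤ μ * level143 P.consts (C.d Y) (P.vol Y)) :
    ‖P.ofPotentials V Q μ hV hQ‖ ≤ μ :=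
  P.frame.norm_ofBound_le _ hμ _

end PotFrame

end Potentials

/-! ## §3 The history margin (RULE R6: dilation slack of the budget ball, in the units of §2) -/

section Margin

/-- [folklore] The history margin of the model in the units of §2: the class is the ball of radius `lam` (an admissible complex
dilation of the potential family, record §27), the actual potentials have budget fraction `μ`, and the margin is `lam − μ` at every
step (the `k`-dependence sits in the weights). -/
def histMargin (lam μ : ℝ) : ℕ → ℝ := fun _ => lam - μ

/-- [folklore] The margin is positive iff the budget fraction is below the class radius (`StepModel.rHist_pos`). -/
theorem histMargin_pos {lam μ : ℝ} (h : μ < lam) (k : ℕ) : 0 < histMargin lam μ k := sub_pos.2 h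

end Margin

end Summit.QuantumFields.BalabanUV.T4Continuum.B13HistDatum

end
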